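import Literature.NumberTheory.GaloisRepresentations.LiftingObstruction
import HarnessLib

/-!
# Change of section and change of frame for Mazur's defect cocycle

Topic `Literature/NumberTheory/GaloisRepresentations`.  Two cochain identities for the defect
cocycle `c_s(σ, τ) = s(ρσ) s(ρτ) s(ρ(στ))⁻¹ − 1` of `LiftingObstruction.lean` (`φ : B ↠ A` with
square-zero kernel `I`, `ρ : G → GL_n(A)`, `s` a set-theoretic lift of `GL_n(φ)`):

* `liftDefect_sub_liftDefect` — **independence of the section up to a coboundary**: for two
  sections `s, s'`, `c_{s'} − c_s = ∂β` with `β(σ) = s'(ρσ) s(ρσ)⁻¹ − 1 ∈ M_n(I)`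
  (`∂β(σ, τ) = s(ρσ) β(τ) s(ρσ)⁻¹ − β(στ) + β(σ)`), so the obstruction CLASS does not depend on
  `s` ([Maz89, §1.6, proof of Prop. 2]);
* `frameSection`, `liftDefect_frameSection` — **change of frame**: for `N ∈ GL_n(A)` with a lift
  `P ∈ GL_n(B)`, a homomorphism `ι : H → G` and `ρ'` with `N ρ'(σ) N⁻¹ = ρ(ι σ)` (e.g. the
  restriction of `ρ` to a decomposition group written in an adapted frame), the section
  `s''(g) = P⁻¹ s(N g N⁻¹) P` satisfies `c_{s''}(ρ')(σ, τ) = P⁻¹ c_s(ρ)(ι σ, ι τ) P` — the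
  restriction of the global defect cocycle, conjugated into the frame, IS a defect cocycle of the
  framed local representation.

Together these give the compatibility `res_v(o_glob) = incl(o_v)` of the global and local
(Borel) obstruction classes up to the explicit coboundary `∂β_v` — the third component of the
cone cocycle in the relation count for nearly ordinary deformation rings (Böckle 2007, §5 and
Thm. 7.6).  Everything is proved; no named facts.

## References

* B. Mazur, *Deforming Galois representations*, MSRI Publ. 16 (1989), §1.6 Prop. 2.
  [cite: Mazur1989Deforming, §1.6 Prop. 2]
* G. Böckle, *Presentations of universal deformation rings*, LMS LNS 320 (2007), §5, Thm. 7.6.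
  [cite: Bockle2007Presentations, Theorem 7.6]
-/

noncomputable section

namespace Literature.NumberTheory.GaloisRepresentations

namespace LiftingObstruction

open Matrix

variable {n : Type*} [Fintype n] [DecidableEq n] {A B : Type*} [CommRing A] [CommRing B]
  {φ : B →+* A} (hI : ∀ x ∈ RingHom.ker φ, ∀ y ∈ RingHom.ker φ, x * y = 0)
  {G : Type*} [Group G] {s s' : GL n A → GL n B}
  (hs : ∀ g, Matrix.GeneralLinearGroup.map φ (s g) = g)
  (hs' : ∀ g, Matrix.GeneralLinearGroup.map φ (s' g) = g) (ρ : G →* GL n A)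

/-! ## 1. Independence of the section -/

/-- The comparison cochain `β(σ) = s'(ρσ) s(ρσ)⁻¹ − 1` of two sections. [cite: Mazur1989Deforming, §1.6 Prop. 2] -/
def sectionDiff (s s' : GL n A → GL n B) (ρ : G →* GL n A) (σ : G) : Matrix n n B :=
  ((s' (ρ σ) * (s (ρ σ))⁻¹ : GL n B) : Matrix n n B) - 1

include hs hs' in
/-- `s'(ρσ) s(ρσ)⁻¹ ↦ 1`. [folklore] -/
theorem map_sectionQuot_eq_one (σ : G) :
    Matrix.GeneralLinearGroup.map φ (s' (ρ σ) * (s (ρ σ))⁻¹) = 1 := by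
  rw [map_mul, map_inv, hs, hs', mul_inv_cancel]

include hs hs' in
/-- `β(σ) ∈ M_n(I)`. [cite: Mazur1989Deforming, §1.6 Prop. 2] -/
theorem sectionDiff_mem (σ : G) : sectionDiff s s' ρ σ ∈ kerMatrix φ :=
  val_sub_one_mem _ (map_sectionQuot_eq_one hs hs' ρ σ)

include hI hs hs' in
/-- **Independence of the section up to a coboundary**: `c_{s'}(σ, τ) − c_s(σ, τ) =
s(ρσ) β(τ) s(ρσ)⁻¹ − β(στ) + β(σ)`. [cite: Mazur1989Deforming, §1.6 Prop. 2] -/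
theorem liftDefect_sub_liftDefect (σ τ : G) :
    liftDefect s' ρ σ τ - liftDefect s ρ σ τ =
      (s (ρ σ) : Matrix n n B) * sectionDiff s s' ρ τ * ((s (ρ σ))⁻¹ : GL n B) -
        sectionDiff s s' ρ (σ * τ) + sectionDiff s s' ρ σ := by
  -- `D_g = s'(g) s(g)⁻¹ ↦ 1`, `s'(g) = D_g s(g)`
  set D : G → GL n B := fun σ => s' (ρ σ) * (s (ρ σ))⁻¹ with hDdef
  have hD : ∀ σ, Matrix.GeneralLinearGroup.map φ (D σ) = 1 := map_sectionQuot_eq_one hs hs' ρ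
  have hsD : ∀ σ, s' (ρ σ) = D σ * s (ρ σ) := fun σ => by
    rw [hDdef]
    group
  -- `γ' = D_σ (s_σ D_τ s_σ⁻¹) γ D_{στ}⁻¹`
  have hγ : defectUnit s' ρ σ τ =
      D σ * (s (ρ σ) * D τ * (s (ρ σ))⁻¹) * defectUnit s ρ σ τ * (D (σ * τ))⁻¹ := by
    rw [defectUnit, defectUnit, hsD σ, hsD τ, hsD (σ * τ)]
    group
  have hC : Matrix.GeneralLinearGroup.map φ (s (ρ σ) * D τ * (s (ρ σ))⁻¹) = 1 := by
    rw [map_mul, map_mul, hD, mul_one, map_inv, mul_inv_cancel]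
  have hγmap : Matrix.GeneralLinearGroup.map φ (defectUnit s ρ σ τ) = 1 := map_defectUnit hs ρ σ τ
  have hDinv : Matrix.GeneralLinearGroup.map φ (D (σ * τ))⁻¹ = 1 := by rw [map_inv, hD, inv_one]
  have h1 : Matrix.GeneralLinearGroup.map φ (D σ * (s (ρ σ) * D τ * (s (ρ σ))⁻¹)) = 1 := by
    rw [map_mul, hD, hC, one_mul]
  have h2 : Matrix.GeneralLinearGroup.map φ
      (D σ * (s (ρ σ) * D τ * (s (ρ σ))⁻¹) * defectUnit s ρ σ τ) = 1 := by
    rw [map_mul, h1, hγmap, one_mul]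
  have e1 : liftDefect s' ρ σ τ =
      ((D σ : Matrix n n B) - 1) +
        ((s (ρ σ) : Matrix n n B) * ((D τ : Matrix n n B) - 1) * ((s (ρ σ))⁻¹ : GL n B)) +
        liftDefect s ρ σ τ + -((D (σ * τ) : Matrix n n B) - 1) := by
    rw [liftDefect, hγ, val_mul_sub_one hI _ _ h2 hDinv, val_mul_sub_one hI _ _ h1 hγmap,
      val_mul_sub_one hI _ _ (hD σ) hC, val_conj_sub_one, val_inv_eq_of_map_eq_one hI _ (hD _),
      ← liftDefect]
    abel
  rw [e1]
  unfold sectionDiff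
  abel

/-! ## 2. Change of frame -/

variable {H : Type*} [Group H] (ι : H →* G) (N : GL n A) (P : GL n B)
  (hP : Matrix.GeneralLinearGroup.map φ P = N)
  (ρ' : H →* GL n A) (hρ' : ∀ σ, N * ρ' σ * N⁻¹ = ρ (ι σ))

/-- The **framed section** `s''(g) = P⁻¹ s(N g N⁻¹) P`. [folklore] -/
def frameSection (s : GL n A → GL n B) (N : GL n A) (P : GL n B) (g : GL n A) : GL n B :=
  P⁻¹ * s (N * g * N⁻¹) * P

include hs hP in
/-- `frameSection` is a section of `GL_n(φ)` when `P` lifts `N`. [folklore] -/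
theorem map_frameSection (g : GL n A) :
    Matrix.GeneralLinearGroup.map φ (frameSection s N P g) = g := by
  rw [frameSection, map_mul, map_mul, map_inv, hs, hP]
  group

include hρ' in
/-- `s''(ρ' g) = P⁻¹ s(ρ(ι g)) P`. [folklore] -/
theorem frameSection_apply_rep (s : GL n A → GL n B) (P : GL n B) (σ : H) :
    frameSection s N P (ρ' σ) = P⁻¹ * s (ρ (ι σ)) * P := by
  rw [frameSection, hρ']

include hρ' in
/-- The framed defect is the conjugate of the restricted defect:
`γ_{s''}(ρ')(σ, τ) = P⁻¹ γ_s(ρ)(ι σ, ι τ) P`. [folklore] -/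
theorem defectUnit_frameSection (s : GL n A → GL n B) (P : GL n B) (σ τ : H) :
    defectUnit (frameSection s N P) ρ' σ τ = P⁻¹ * defectUnit s ρ (ι σ) (ι τ) * P := by
  rw [defectUnit, defectUnit, frameSection_apply_rep ρ ι N ρ' hρ',
    frameSection_apply_rep ρ ι N ρ' hρ', frameSection_apply_rep ρ ι N ρ' hρ', map_mul]
  group

include hρ' in
/-- **Change of frame**: the defect cocycle of the framed representation `ρ'` for the framed
section is the restricted defect cocycle of `ρ` conjugated into the frame,
`c_{s''}(ρ')(σ, τ) = P⁻¹ c_s(ρ)(ι σ, ι τ) P`. [cite: Bockle2007Presentations, Theorem 7.6] -/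
theorem liftDefect_frameSection (s : GL n A → GL n B) (P : GL n B) (σ τ : H) :
    liftDefect (frameSection s N P) ρ' σ τ =
      ((P⁻¹ : GL n B) : Matrix n n B) * liftDefect s ρ (ι σ) (ι τ) * (P : Matrix n n B) := by
  have hPP : ((P⁻¹ : GL n B) : Matrix n n B) * (P : Matrix n n B) = 1 := by
    rw [← Units.val_mul, inv_mul_cancel, Units.val_one]
  rw [liftDefect, defectUnit_frameSection ρ ι N ρ' hρ', liftDefect, Units.val_mul, Units.val_mul,
    mul_sub, sub_mul, mul_one, hPP]

end LiftingObstruction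

end Literature.NumberTheory.GaloisRepresentations
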